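import Mathlib
import HarnessLib
import Summits.SmoothPoincare4.Statement
import Summits.SmoothPoincare4.SmoothPoincare4.Theses.TropicalFanoSkeleton
import Summits.SmoothPoincare4.SmoothPoincare4.Theses.LogCYSkeleton
import Literature.Topology.FourManifolds.SmoothTriangulation
import Literature.Topology.FourManifolds.HomotopyS4CompactProofs

/-!
# Strength probes for crux `TropicalCollapse` (stmt-SmoothPoincare4-15643) — redirect strategist r1

Kernel-checked bookkeeping of WHERE the summit sits inside route `TropicalFanoSkeleton`
(`closes : TropicalBall → TropicalCollapse → CertificateRecognition → SmoothPoincare4`).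

* `TropicalCollapseHS` — the crux restricted to homotopy 4-spheres: the ONLY instance `closes`
  consumes (`closes_hs`).  It is a CONSEQUENCE of the summit modulo the calibration fact
  `LogCYSkeleton.SimplexBoundaryCertificate` (the round `S⁴` has a skeleton certificate):
  `hs_of_spc4`.
* `TropicalBall` is likewise a consequence of the summit modulo `SimplexTropicalCalibration`
  (`tropicalBall_of_spc4`), and conversely `TropicalBall ∧ TropicalCollapseHS ∧ CertificateRecognition
  → SmoothPoincare4`; hence `spc4_iff_ball_and_hs`: modulo the two calibration facts about the round
  sphere and recognition, **SPC4 ⟺ TropicalBall ∧ TropicalCollapseHS** — a conjunct split, with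
  `TropicalBall ⟺ SPC4` given the other conjunct (`tropicalBall_iff_spc4`): the summit-equivalent
  ("residual") item of the route is `TropicalBall`, not `TropicalCollapse`.
* `TropicalCollapse` itself (all `M`, as typed) = `TropicalCollapseHS` + an UNUSED strengthening;
  the repaired form `TropicalCollapseConn` (refuter's fix `[ConnectedSpace M]`) factors as
  `TropicalHomotopyRigidity → TropicalCollapseHS → TropicalCollapseConn` (`conn_of_rigidity_of_hs`),
  separating the killable topological-rigidity content (tropical data force a homotopy sphere) from
  the summit-adjacent content.

No route item is proved here; nothing is asserted about the truth of any crux.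
-/

noncomputable section

set_option linter.dupNamespace false

open scoped Manifold ContDiff ContinuousMap BigOperators Matrix
open Literature.Topology.FourManifolds

namespace Summit.SmoothPoincare4.SmoothPoincare4.Cruxes.TropicalCollapse.Strength

open Summit.SmoothPoincare4.SmoothPoincare4.Theses

/-- The positive integral tropical fan datum clause of the route items (verbatim). -/
def IsTropicalDatum (N : ℕ) (K : Geometry.SimplicialComplex ℝ (EuclideanSpace ℝ (Fin N)))
    (v₀ : EuclideanSpace ℝ (Fin N))
    (x : EuclideanSpace ℝ (Fin N) → EuclideanSpace ℝ (Fin N) → (Fin 4 → ℝ)) : Prop :=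
  (∀ a w i, ∃ z : ℤ, x a w i = z) ∧ (∀ a, x a a = 0) ∧ (∀ a : EuclideanSpace ℝ (Fin N), ({a} : Finset (EuclideanSpace ℝ (Fin N))) ∈ K.faces → a ≠ v₀ → (∀ σ ∈ K.faces, a ∈ σ → σ.card = 5 → ∀ f : Fin 4 → EuclideanSpace ℝ (Fin N), Function.Injective f → (∀ i, f i ∈ σ.erase a) → |Matrix.det (Matrix.of fun i j => x a (f i) j)| = 1) ∧ (∀ τ ∈ K.faces, ∀ τ' ∈ K.faces, a ∈ τ → a ∈ τ' → {y : Fin 4 → ℝ | ∃ c : EuclideanSpace ℝ (Fin N) → ℝ, (∀ w, 0 ≤ c w) ∧ y = ∑ w ∈ (τ).erase a, c w • x a w} ∩ {y : Fin 4 → ℝ | ∃ c : EuclideanSpace ℝ (Fin N) → ℝ, (∀ w, 0 ≤ c w) ∧ y = ∑ w ∈ (τ').erase a, c w • x a w} = {y : Fin 4 → ℝ | ∃ c : EuclideanSpace ℝ (Fin N) → ℝ, (∀ w, 0 ≤ c w) ∧ y = ∑ w ∈ (τ ∩ τ').erase a, c w • x a w}) ∧ (⋃ τ ∈ {τ ∈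 K.faces | a ∈ τ}, {y : Fin 4 → ℝ | ∃ c : EuclideanSpace ℝ (Fin N) → ℝ, (∀ w, 0 ≤ c w) ∧ y = ∑ w ∈ (τ).erase a, c w • x a w}) = Set.univ ∧ (∃ m : Finset (EuclideanSpace ℝ (Fin N)) → (Fin 4 → ℝ), ∀ σ ∈ K.faces, ∀ σ' ∈ K.faces, a ∈ σ → a ∈ σ' → σ.card = 5 → σ'.card = 5 → ∀ y ∈ {y : Fin 4 → ℝ | ∃ c : EuclideanSpace ℝ (Fin N) → ℝ, (∀ w, 0 ≤ c w) ∧ y = ∑ w ∈ (σ).erase a, c w • x a w}, (∑ i, m σ' i * y i ≤ ∑ i, m σ i * y i) ∧ ((∑ i, m σ' i * y i = ∑ i, m σ i * y i) → y ∈ {y : Fin 4 → ℝ | ∃ c : EuclideanSpace ℝ (Fin N) → ℝ, (∀ w, 0 ≤ c w) ∧ y = ∑ w ∈ (σ').erase a, c w • x a w}))) ∧ (∀ ρ ∈ K.faces, ρ.card = 4 → ∀ σp ∈ K.faces, ∀ σm ∈ K.faces, σp.card = 5 → σm.card = 5 → ρ ⊆ σp → ρ ⊆ σm → σp ≠ σm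 → ∀ a ∈ ρ, ∀ b ∈ ρ, a ≠ b → a ≠ v₀ → b ≠ v₀ → ∀ ψp ψm : (Fin 4 → ℝ) →ᵃ[ℝ] (Fin 4 → ℝ), (∀ w ∈ σp, w ≠ v₀ → ψp (x a w) = x b w) → (v₀ ∈ σp → ψp.linear (x a v₀) = x b v₀) → (∀ w ∈ σm, w ≠ v₀ → ψm (x a w) = x b w) → (v₀ ∈ σm → ψm.linear (x a v₀) = x b v₀) → ∀ wp ∈ σp, wp ∉ ρ → ∀ g : Fin 3 → EuclideanSpace ℝ (Fin N), Function.Injective g → (∀ i, g i ∈ ρ.erase a) → ∃ κ : ℝ, 0 ≤ κ ∧ ∀ y : Fin 4 → ℝ, ψp y = ψm (y + (κ * Matrix.det (Matrix.of ![y, x a (g 0), x a (g 1), x a (g 2)]) * Matrix.det (Matrix.of ![x a wp, x a (g 0), x a (g 1), x a (g 2)])) • x a b))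

/-- Skeleton certificate for `M` (verbatim the conclusion of `TropicalCollapse` / hypothesis of
`CertificateRecognition`). -/
def HasCertificate (M : Type) [TopologicalSpace M] [ChartedSpace (EuclideanSpace ℝ (Fin 4)) M] : Prop :=
  ∃ (N' : ℕ) (K' : Geometry.SimplicialComplex ℝ (EuclideanSpace ℝ (Fin N'))) (h' : K'.space ≃ₜ M), Literature.Topology.FourManifolds.IsSmoothTriangulation 4 K' h' ∧ ∃ v : EuclideanSpace ℝ (Fin N'), ({v} : Finset (EuclideanSpace ℝ (Fin N'))) ∈ K'.faces ∧ ∃ w : EuclideanSpace ℝ (Fin N'), Relation.ReflTransGen (fun F G : Set (Finset (EuclideanSpace ℝ (Fin N'))) => ∃ σ τ : Finset (EuclideanSpace ℝ (Fin N')), (σ ∈ F ∧ τ ∈ F ∧ σ ⊂ τ ∧ τ.card = σ.card + 1 ∧ ∀ ρ ∈ F, σ ⊂ ρ → ρ = τ) ∧ G = F \ {σ, τ}) {s ∈ K'.faces | v ∉ s} {({w} : Finset (EuclideanSpace ℝ (Fin N')))}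

/-- `TropicalCollapse` unfolds to the readable form. -/
theorem tropicalCollapse_iff :
    TropicalFanoSkeleton.TropicalCollapse ↔
      ∀ (M : Type) [TopologicalSpace M] [T2Space M] [SecondCountableTopology M] [ChartedSpace (EuclideanSpace ℝ (Fin 4)) M] [IsManifold (𝓡 4) (⊤ : ℕ∞) M], ∀ (N : ℕ) (K : Geometry.SimplicialComplex ℝ (EuclideanSpace ℝ (Fin N))) (h : K.space ≃ₜ M), IsSmoothTriangulation 4 K h → ∀ v₀ : EuclideanSpace ℝ (Fin N), ({v₀} : Finset (EuclideanSpace ℝ (Fin N))) ∈ K.faces → ∀ x : EuclideanSpace ℝ (Fin N) → EuclideanSpace ℝ (Fin N) → (Fin 4 → ℝ), IsTropicalDatum N K v₀ x → HasCertificate M :=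
  Iff.rfl

/-- `TropicalBall` unfolds to the readable form. -/
theorem tropicalBall_iff :
    TropicalFanoSkeleton.TropicalBall ↔
      ∀ (M : Type) [TopologicalSpace M] [T2Space M] [SecondCountableTopology M] [ChartedSpace (EuclideanSpace ℝ (Fin 4)) M] [IsManifold (𝓡 4) (⊤ : ℕ∞) M], M ≃ₕ Metric.sphere (0 : EuclideanSpace ℝ (Fin 5)) 1 → ∃ (N : ℕ) (K : Geometry.SimplicialComplex ℝ (EuclideanSpace ℝ (Fin N))) (h : K.space ≃ₜ M), IsSmoothTriangulation 4 K h ∧ ∃ v₀ : EuclideanSpace ℝ (Fin N), ({v₀} : Finset (EuclideanSpace ℝ (Fin N))) ∈ K.faces ∧ ∃ x : EuclideanSpace ℝ (Fin N) → EuclideanSpace ℝ (Fin N) → (Fin 4 → ℝ), IsTropicalDatum N K v₀ x :=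
  Iff.rfl

/-- `CertificateRecognition` unfolds to the readable form. -/
theorem certificateRecognition_iff :
    TropicalFanoSkeleton.CertificateRecognition ↔
      ∀ (M : Type) [TopologicalSpace M] [T2Space M] [SecondCountableTopology M] [ChartedSpace (EuclideanSpace ℝ (Fin 4)) M] [IsManifold (𝓡 4) (⊤ : ℕ∞) M], HasCertificate M → Nonempty (Diffeomorph (𝓡 4) (𝓡 4) M (Metric.sphere (0 : EuclideanSpace ℝ (Fin 5)) 1) (⊤ : ℕ∞)) :=
  Iff.rfl

/-- `SimplexTropicalCalibration` unfolds to the readable form. -/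
theorem simplexTropicalCalibration_iff :
    TropicalFanoSkeleton.SimplexTropicalCalibration ↔
      ∃ (N : ℕ) (K : Geometry.SimplicialComplex ℝ (EuclideanSpace ℝ (Fin N))) (h : K.space ≃ₜ Metric.sphere (0 : EuclideanSpace ℝ (Fin 5)) 1), IsSmoothTriangulation 4 K h ∧ ∃ v₀ : EuclideanSpace ℝ (Fin N), ({v₀} : Finset (EuclideanSpace ℝ (Fin N))) ∈ K.faces ∧ ∃ x : EuclideanSpace ℝ (Fin N) → EuclideanSpace ℝ (Fin N) → (Fin 4 → ℝ), IsTropicalDatum N K v₀ x :=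
  Iff.rfl

/-- The corpse's calibration item: the round `S⁴` has a skeleton certificate. -/
theorem simplexBoundaryCertificate_iff :
    LogCYSkeleton.SimplexBoundaryCertificate ↔ HasCertificate (Metric.sphere (0 : EuclideanSpace ℝ (Fin 5)) 1) :=
  Iff.rfl

/-! ## The pieces -/

/-- **TC|hs** — `TropicalCollapse` restricted to homotopy 4-spheres (the only instance `closes` uses). -/
def TropicalCollapseHS : Prop :=
  ∀ (M : Type) [TopologicalSpace M] [T2Space M] [SecondCountableTopology M] [ChartedSpace (EuclideanSpace ℝ (Fin 4)) M] [IsManifold (𝓡 4) (⊤ : ℕ∞) M], M ≃ₕ Metric.sphere (0 : EuclideanSpace ℝ (Fin 5)) 1 → ∀ (N : ℕ) (K : Geometry.SimplicialComplex ℝ (EuclideanSpace ℝ (Fin N))) (h : K.space ≃ₜ M), IsSmoothTriangulation 4 K h → ∀ v₀ : EuclideanSpace ℝ (Fin N), ({v₀} : Finset (EuclideanSpace ℝ (Fin N))) ∈ K.faces → ∀ x : EuclideanSpace ℝ (Fin N) → EuclideanSpace ℝ (Fin N) → (Fin 4 → ℝ), IsTropicalDatum N K v₀ x → HasCertificate 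M

/-- **C′** — the refuter's repaired crux (`[ConnectedSpace M]` inserted; VETTING.md on the item). -/
def TropicalCollapseConn : Prop :=
  ∀ (M : Type) [TopologicalSpace M] [T2Space M] [SecondCountableTopology M] [ChartedSpace (EuclideanSpace ℝ (Fin 4)) M] [IsManifold (𝓡 4) (⊤ : ℕ∞) M] [ConnectedSpace M], ∀ (N : ℕ) (K : Geometry.SimplicialComplex ℝ (EuclideanSpace ℝ (Fin N))) (h : K.space ≃ₜ M), IsSmoothTriangulation 4 K h → ∀ v₀ : EuclideanSpace ℝ (Fin N), ({v₀} : Finset (EuclideanSpace ℝ (Fin N))) ∈ K.faces → ∀ x : EuclideanSpace ℝ (Fin N) → EuclideanSpace ℝ (Fin N) → (Fin 4 → ℝ), IsTropicalDatum N K v₀ x → HasCertificate M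

/-- **Sub₁ (topological rigidity shadow)** — positive integral tropical fan data on a vertex-complement
of a smooth triangulation of a CONNECTED smooth 4-manifold force a homotopy 4-sphere. -/
def TropicalHomotopyRigidity : Prop :=
  ∀ (M : Type) [TopologicalSpace M] [T2Space M] [SecondCountableTopology M] [ChartedSpace (EuclideanSpace ℝ (Fin 4)) M] [IsManifold (𝓡 4) (⊤ : ℕ∞) M] [ConnectedSpace M], ∀ (N : ℕ) (K : Geometry.SimplicialComplex ℝ (EuclideanSpace ℝ (Fin N))) (h : K.space ≃ₜ M), IsSmoothTriangulation 4 K h → ∀ v₀ : EuclideanSpace ℝ (Fin N), ({v₀} : Finset (EuclideanSpace ℝ (Fin N))) ∈ K.faces → ∀ x : EuclideanSpace ℝ (Fin N) → EuclideanSpace ℝ (Fin N) → (Fin 4 → ℝ), IsTropicalDatum N K v₀ x → Nonempty (M ≃ₕ Metric.sphere (0 : EuclideanSpace ℝ (Fin 5)) 1)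

/-! ## Bookkeeping theorems -/

theorem hs_of_tropicalCollapse : TropicalFanoSkeleton.TropicalCollapse → TropicalCollapseHS :=
  fun h M _ _ _ _ _ _ => h M

theorem conn_of_tropicalCollapse : TropicalFanoSkeleton.TropicalCollapse → TropicalCollapseConn :=
  fun h M _ _ _ _ _ _ => h M

theorem hs_of_conn : TropicalCollapseConn → TropicalCollapseHS := by
  intro h M _ _ _ _ _ e
  haveI : PathConnectedSpace M := by
    haveI := pathConnectedSpace_sphere_four
    exact pathConnectedSpace_of_homotopyEquiv e
  exact h M

/-- The recommended re-target shape: C′ ⇐ Sub₁ ∧ TC|hs (modus ponens). -/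
theorem conn_of_rigidity_of_hs : TropicalHomotopyRigidity → TropicalCollapseHS → TropicalCollapseConn := by
  intro hR hC M _ _ _ _ _ _ N K h hK v₀ hv₀ x hx
  obtain ⟨e⟩ := hR M N K h hK v₀ hv₀ x hx
  exact hC M e N K h hK v₀ hv₀ x hx

/-- `closes` only consumes TC|hs. -/
theorem closes_hs (hTB : TropicalFanoSkeleton.TropicalBall) (hTC : TropicalCollapseHS)
    (hR : TropicalFanoSkeleton.CertificateRecognition) : _root_.SmoothPoincare4 := by
  intro M _ _ _ _ _ e
  obtain ⟨N, K, h, hK, v₀, hv₀, x, hx⟩ := hTB M e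
  exact hR M (hTC M e N K h hK v₀ hv₀ x hx)

/-- **TropicalBall is a consequence of the summit** (modulo the calibration item): transport the
calibration datum of the round sphere along the diffeomorphism SPC4 provides. -/
theorem tropicalBall_of_spc4 (hCal : TropicalFanoSkeleton.SimplexTropicalCalibration)
    (hS : _root_.SmoothPoincare4) : TropicalFanoSkeleton.TropicalBall := by
  intro M _ _ _ _ _ e
  obtain ⟨d⟩ := hS M ‹_› ‹_› e
  obtain ⟨N, K, h, hK, v₀, hv₀, x, hx⟩ := hCal
  exact ⟨N, K, h.trans d.symm.toHomeomorph, hK.trans_diffeomorph d.symm, v₀, hv₀, x, hx⟩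

/-- **TC|hs is a consequence of the summit** (modulo the corpse's calibration item
`SimplexBoundaryCertificate`): transport the round sphere's certificate along the diffeomorphism. -/
theorem hs_of_spc4 (hCert : LogCYSkeleton.SimplexBoundaryCertificate)
    (hS : _root_.SmoothPoincare4) : TropicalCollapseHS := by
  intro M _ _ _ _ _ e N K h hK v₀ hv₀ x hx
  obtain ⟨d⟩ := hS M ‹_› ‹_› e
  obtain ⟨N', K', h', hK', v, hv, w, hw⟩ := hCert
  exact ⟨N', K', h'.trans d.symm.toHomeomorph, hK'.trans_diffeomorph d.symm, v, hv, w, hw⟩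

/-- **Where the summit is.** Given TC|hs, recognition and the calibration, `TropicalBall ⟺ SPC4`. -/
theorem tropicalBall_iff_spc4 (hTC : TropicalCollapseHS)
    (hR : TropicalFanoSkeleton.CertificateRecognition)
    (hCal : TropicalFanoSkeleton.SimplexTropicalCalibration) :
    TropicalFanoSkeleton.TropicalBall ↔ _root_.SmoothPoincare4 :=
  ⟨fun hTB => closes_hs hTB hTC hR, tropicalBall_of_spc4 hCal⟩

/-- Given TropicalBall, recognition and the sphere certificate, `TC|hs ⟺ SPC4`. -/
theorem hs_iff_spc4 (hTB : TropicalFanoSkeleton.TropicalBall)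
    (hR : TropicalFanoSkeleton.CertificateRecognition)
    (hCert : LogCYSkeleton.SimplexBoundaryCertificate) :
    TropicalCollapseHS ↔ _root_.SmoothPoincare4 :=
  ⟨fun hTC => closes_hs hTB hTC hR, hs_of_spc4 hCert⟩

/-- **Conjunct split.** Modulo recognition and the two calibration facts about the round `S⁴`,
`SPC4 ⟺ TropicalBall ∧ TC|hs`. -/
theorem spc4_iff_ball_and_hs (hR : TropicalFanoSkeleton.CertificateRecognition)
    (hCal : TropicalFanoSkeleton.SimplexTropicalCalibration)
    (hCert : LogCYSkeleton.SimplexBoundaryCertificate) :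
    _root_.SmoothPoincare4 ↔ TropicalFanoSkeleton.TropicalBall ∧ TropicalCollapseHS :=
  ⟨fun hS => ⟨tropicalBall_of_spc4 hCal hS, hs_of_spc4 hCert hS⟩, fun h => closes_hs h.1 h.2 hR⟩

/-- The typed crux implies the summit only through `TropicalBall` (restating `closes`). -/
theorem spc4_of_tropicalCollapse (hTB : TropicalFanoSkeleton.TropicalBall)
    (hR : TropicalFanoSkeleton.CertificateRecognition)
    (hTC : TropicalFanoSkeleton.TropicalCollapse) : _root_.SmoothPoincare4 :=
  closes_hs hTB (hs_of_tropicalCollapse hTC) hR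

end Summit.SmoothPoincare4.SmoothPoincare4.Cruxes.TropicalCollapse.Strength
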